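import Mathlib
import Summits.Ventures.HodgeRepro.Tier4.Common.LocalTorus
import Summits.Ventures.HodgeRepro.Tier4.Common.LocalTorusCompact
import Summits.Ventures.HodgeRepro.Tier4.Line1.FiniteLevelIsolation

/-!
# Tier4/Line4/FinitePartClosed — `G(𝔸_f)` is closed in `G(𝔸_k)`

Blind re-derivation cell `pub-hodge-repro`, Tier 4 «prove the step» (README §9–§10), seat t4-L4-p2 (prover, LINE L4,
gen 3). Tree path `lean/Summits/Ventures/HodgeRepro/Tier4/Line4/FinitePartClosed.lean`. Mathlib-level; no literature.

The twin of L1's `isClosed_infinitePart` (FiniteLevelIsolation): the subgroup `finitePart W` («every archimedean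
component `= 1`», `Common.LocalTorus`) is closed in `G(𝔸_k)`, by the `isClosed_atPlace` pattern of
`Common.LocalTorusCompact` (the archimedean matrix entries are continuous, the completions are Hausdorff). Consumers:
the factorisation chain of plan-4 S14430 — the factor tori `torusFin`, `torusFin'` (TORUSPROD, L2-p1) are the preimages
of `finitePart W` under the continuous `Subtype.val`, hence closed in `T(𝔸)`, `T′(𝔸)`, hence locally compact and
σ-compact (INNERSPLIT, this seat).

Nothing here says anything about the status of the Hodge conjecture for CM abelian varieties, which is NOT proved
(HC_CM is NOT proved by anyone in this repository).
-/

set_option autoImplicit false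
noncomputable section
namespace Summit.Ventures.HodgeRepro.Tier4.Line4
open Summit.Ventures.HodgeRepro.Tier4 Summit.Ventures.HodgeRepro.Tier4.Common
  Summit.Ventures.HodgeRepro.Tier4.Line1 NumberField

variable {k : Type} [Field k] [NumberField k] (W : PlaneData k)

/-- `G(𝔸_f)` (every archimedean component `= 1`) is closed in `G(𝔸_k)` (twin of `isClosed_infinitePart`). -/
theorem isClosed_finitePart : IsClosed (finitePart W : Set (GA W)) := by
  have hmat : ∀ i j, Continuous fun g : GA W => GA.mat W g i j :=
    fun i j => (Units.continuous_val.comp continuous_subtype_val).matrix_elem i j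
  have hinf : ∀ w' : InfinitePlace k, IsClosed {g : GA W | GA.infiniteComponent W w' g = 1} := by
    intro w'
    have : {g : GA W | GA.infiniteComponent W w' g = 1} = ⋂ i, ⋂ j,
        {g : GA W | adComponentInf k w' (GA.mat W g i j) = (1 : Matrix (Fin 4) (Fin 4) w'.Completion) i j} := by
      ext g
      simp only [Set.mem_setOf_eq, Set.mem_iInter]
      exact infiniteComponent_eq_one_iff W w' g
    rw [this]
    refine isClosed_iInter fun i => isClosed_iInter fun j => isClosed_eq ?_ continuous_const
    exact (continuous_apply w').comp (continuous_fst.comp (hmat i j))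
  have : (finitePart W : Set (GA W)) = ⋂ w' : InfinitePlace k, {g : GA W | GA.infiniteComponent W w' g = 1} := by
    ext g
    simp only [SetLike.mem_coe, Set.mem_iInter, Set.mem_setOf_eq]
    exact mem_finitePart W g
  rw [this]
  exact isClosed_iInter hinf

/-- A subgroup of `G(𝔸_k)` cut out inside a subgroup `H` by `finitePart W` is closed in `H`. -/
theorem isClosed_subgroupOf_finitePart (H : Subgroup (GA W)) :
    IsClosed (((finitePart W).subgroupOf H : Set H)) :=
  (isClosed_finitePart W).preimage continuous_subtype_val

/-- A subgroup of `G(𝔸_k)` cut out inside a subgroup `H` by `infinitePart W` is closed in `H`. -/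
theorem isClosed_subgroupOf_infinitePart (H : Subgroup (GA W)) :
    IsClosed (((infinitePart W).subgroupOf H : Set H)) :=
  (isClosed_infinitePart W).preimage continuous_subtype_val

end Summit.Ventures.HodgeRepro.Tier4.Line4
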